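import Literature.AlgebraicGeometry.Motives.CyclotomicFieldSevenOrientation
import Literature.AlgebraicGeometry.Motives.HodgeStructureOfOrientationKubotaRank
import Literature.NumberTheory.ComplexMultiplication.OrientedTypeRank
import Mathlib.NumberTheory.Cyclotomic.Gal
import HarnessLib

/-!
# The cyclic sextic witness is Green–Griffiths–Kerr's (V.A.8) orientation of `ℚ(ζ₇)`: `𝓡(F,Π) = 3 < 4`, primitive, DEGENERATE
# ((V.A.9)(iii) fails in weight `2`) — and `−id ∉ M_φ`

[topic AlgebraicGeometry/Motives]

Layer `Literature/AlgebraicGeometry/Motives`, lane `lit-hodgefound` (Track 2 foundations library; seat `lit-hodgefound-p02`, gen 29, row g29-#6).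
THEOREMS ONLY (no definition, no named fact; D-0026 net debt `0`).  The tree's `Literature/NumberTheory/ComplexMultiplication/OrientedTypeRank` §7
`CounterexampleVA8` (seat p02) formalised GGK's weight-`2` example on `𝒢 = ℤ/6 ≅ Gal(ℚ(ζ₇)/ℚ)` at GROUP level: the degree function `p6 = (1,0,0,1,2,2)`
(`Π^{2,0} = {θ₄,θ₅}`, `Π^{1,1} = {θ₀,θ₃}`, `Π^{0,2} = {θ₁,θ₂}`) has generalized Kubota rank `degRank_p6 : 𝓡 = 3`, trivial right stabiliser (`(F,Π)` primitive,
`[F″:ℚ] = 6`) and is therefore DEGENERATE (`𝓡 ≠ ½[F″:ℚ] + 1 = 4`; `degenerate_of_index_six`: the printed (V.A.9)(iii) «`½[F″:ℚ] ≤ 3 ⟹` nondegenerate» fails in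
weight `2`).  The witness of g29-#3 `Motives/HodgeGroupOfOrientationMinusIdentityCyclicSextic` — degrees `(2,2,1,0,0,1)` along `ι ∘ e⁻¹(i)` — is the SAME
orientation up to the base embedding: `(2,2,1,0,0,1)(x) = p6(x + 4)` (§1).  Hence (§2), for the honest SCMpHS `V²_{(L,Π)}` of g29-#3 (any Galois CM `L` with
`e : Gal(L/ℚ) ≃* ℤ/6`): **`𝓡(L,Π) = kubotaRank = 3`**, `𝒢'_Π = 1` (`galoisStabilizer = ⊥`, `[F″:ℚ] = 6`: primitive), **NOT nondegenerate and NOT strongly nondegenerate**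
— and (g29-#3) `−id ∉ M_φ(V²_{(L,Π)})`: GGK's own degenerate weight-`2` example exhibits the even-weight sign defect of g29-#1 (consistently with g29-#1
`smulOfUnit_neg_one_mem_hodgeGroupBaseChange_real_of_isStronglyNondegenerate`: strongly nondegenerate ⟹ `−id ∈ M_φ`).  §3: unconditionally on `ℚ(ζ₇)` (g29-#5).

THE PRINTS.  [GreenGriffithsKerr2012] (V.A.7) p0157 «generalized Kubota rank … `(F,Π)` is non-degenerate if `𝓡(F,Π) = ½[F″:ℚ] + 1`»; (V.A.8) p0157 (the bound, whose printed
left inequality fails for this `Π` — tree `two_pow_degRank_sub_one_lt_index`); (V.A.9)(iii) p0157; §V p0154 Warning (even weight).  (READING NOTE, proved.)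

WHAT IS PROVED.  §1 `table_eq_p6_mul` (`(2,2,1,0,0,1) = p6(· * 4)`), `degRank_table` (`= 3`, by `degRank_comp` along right translation + `degRank_p6`),
`rightStabilizer_table_eq_bot`.  §2 (hypothesis form of g29-#3) `galoisDeg_eq_table_comp`, **`kubotaRank_eq_three`**, `galoisStabilizer_eq_bot`, `finrank_doubleReflexField_eq_six`,
**`not_isStronglyNondegenerate`**, **`not_isNondegenerate`**, `kubotaRank_eq_three_and_smulOfUnit_neg_one_not_mem`.  §3 **`exists_orientation_cyclotomicField_seven_kubotaRank`**
(on `ℚ(ζ₇)`: `∃ Π`, `𝓡 = 3`, degenerate, not strongly nondegenerate, `[F″:ℚ] = 6`, `−id ∉ M_φ(ℂ)`).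

HONEST SCOPE.  `𝓡 = 3` is GGK's generalized Kubota rank as the tree defines it (`kubotaRank = degRank` of `g ↦ deg(ι ∘ g)`); the identification `dim M_φ̃ = 𝓡` /
`dim M_φ = 𝓡 − 1 = 2` is NOT restated here (tree: `Motives/HodgeStructureOfOrientationKubotaRank*`, `mtRank`).  Nothing geometric.

## References
* [GreenGriffithsKerr2012] M. Green, P. Griffiths, M. Kerr, *Mumford–Tate Groups and Domains* (2012) — (V.A.7)–(V.A.9) p. 157; (V.A.4) p. 156; §V Warning p. 154.
* [Deligne1982HodgeCycles] P. Deligne, *Hodge cycles on abelian varieties*, in LNM 900 (1982) — I Example 3.7 (d).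

## Provenance
Lane `lit-hodgefound` (Hodge path, Track 2), prover seat `lit-hodgefound-p02` (generation 29), self-proposed row g29-#6 (identifying g29-#3/g29-#5 with the tree's (V.A.8) example).
-/

noncomputable section

open scoped TensorProduct Classical
open Module NumberField

namespace Literature.AlgebraicGeometry.Motives

namespace HodgeStructure

open Orientation Literature.NumberTheory.ComplexMultiplication Literature.NumberTheory.ComplexMultiplication.CounterexampleVA8

/-! ### §1 Group level: `(2,2,1,0,0,1)` is the translate `p6(· * 4)`; rank `3`; trivial right stabiliser -/

/-- **`(2,2,1,0,0,1)(x) = p6(x · 4)`** on `ℤ/6` (written multiplicatively): the g29-#3 table is GGK's (V.A.8) degree function `p6 = (1,0,0,1,2,2)` read from the base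
point `θ₄`. [cite: GreenGriffithsKerr2012, (V.A.8) p. 157] -/
theorem table_eq_p6_mul (x : Multiplicative (ZMod 6)) :
    (if (Multiplicative.toAdd x).val ≤ 1 then (2 : ℤ)
      else if (Multiplicative.toAdd x).val = 2 ∨ (Multiplicative.toAdd x).val = 5 then 1 else 0) =
      p6 (x * Multiplicative.ofAdd (4 : ZMod 6)) := by
  revert x
  decide

/-- **`𝓡 = 3` for the table**: the generalized Kubota rank is invariant under right translation (the tree's `degRank_comp` along the `𝒢`-equivariant bijection
`x ↦ x · 4`) and `degRank_p6 = 3`. [cite: GreenGriffithsKerr2012, (V.A.7)–(V.A.8) p. 157] -/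
theorem degRank_table :
    degRank (Multiplicative (ZMod 6)) (fun x : Multiplicative (ZMod 6) =>
      if (Multiplicative.toAdd x).val ≤ 1 then (2 : ℤ)
        else if (Multiplicative.toAdd x).val = 2 ∨ (Multiplicative.toAdd x).val = 5 then 1 else 0) = 3 := by
  have h1 : (fun x : Multiplicative (ZMod 6) =>
      if (Multiplicative.toAdd x).val ≤ 1 then (2 : ℤ)
        else if (Multiplicative.toAdd x).val = 2 ∨ (Multiplicative.toAdd x).val = 5 then 1 else 0) =
      p6 ∘ fun x : Multiplicative (ZMod 6) => x * Multiplicative.ofAdd (4 : ZMod 6) := by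
    funext x
    exact table_eq_p6_mul x
  rw [h1, degRank_comp (G := Multiplicative (ZMod 6)) (fun x : Multiplicative (ZMod 6) => x * Multiplicative.ofAdd (4 : ZMod 6))
    (fun g x => by simp only [smul_eq_mul, mul_assoc]) (mul_right_surjective _) p6]
  exact degRank_p6

/-- **The right stabiliser of the table is trivial** (`𝒢'_Π = 1`: the oriented CM field is primitive, as for `p6`). [cite: GreenGriffithsKerr2012, (V.A.8) p. 157] -/
theorem rightStabilizer_table_eq_bot :
    rightStabilizer (fun x : Multiplicative (ZMod 6) =>
      if (Multiplicative.toAdd x).val ≤ 1 then (2 : ℤ)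
        else if (Multiplicative.toAdd x).val = 2 ∨ (Multiplicative.toAdd x).val = 5 then 1 else 0) = ⊥ := by
  rw [Subgroup.eq_bot_iff_forall]
  intro u hu
  rw [mem_rightStabilizer_iff] at hu
  revert u
  decide

/-! ### §2 The SCMpHS of g29-#3: `𝓡 = 3`, primitive, degenerate, not strongly nondegenerate, `−id ∉ M_φ` -/

section CyclicSextic

variable {L : Type} [Field L] [NumberField L] [IsGalois ℚ L] (ι : L →+* ℂ) (e : (L ≃ₐ[ℚ] L) ≃* Multiplicative (ZMod 6))
  (Λ : Orientation L 2)
  (hΛ : ∀ g : L ≃ₐ[ℚ] L, Λ.deg (ι.comp (g : L →+* L)) =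
    if (Multiplicative.toAdd (e g)).val ≤ 1 then 2
      else if (Multiplicative.toAdd (e g)).val = 2 ∨ (Multiplicative.toAdd (e g)).val = 5 then 1 else 0)

include hΛ

omit [IsGalois ℚ L] in
/-- GGK's function `p(g) = deg(ι ∘ g)` of the witness is the table transported along `e`. [cite: GreenGriffithsKerr2012, (V.A.3) p. 156 and (V.A.7) p. 157] -/
theorem galoisDeg_eq_table_comp :
    Λ.galoisDeg (AlgHom.id ℚ L) ι = (fun x : Multiplicative (ZMod 6) =>
      if (Multiplicative.toAdd x).val ≤ 1 then (2 : ℤ)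
        else if (Multiplicative.toAdd x).val = 2 ∨ (Multiplicative.toAdd x).val = 5 then 1 else 0) ∘ e := by
  funext g
  rw [galoisDeg_apply, Function.comp_apply, ← hΛ g]
  rfl

omit [IsGalois ℚ L] in
/-- **`𝓡(L,Π) = 3`** for the g29-#3 witness (GGK's generalized Kubota rank; `degRank_comp_mulEquiv` along `e`, then §1). [cite: GreenGriffithsKerr2012, (V.A.7)–(V.A.8) p. 157] -/
theorem kubotaRank_eq_three : Λ.kubotaRank (AlgHom.id ℚ L) ι = 3 := by
  rw [kubotaRank_eq_degRank, galoisDeg_eq_table_comp ι e Λ hΛ, degRank_comp_mulEquiv e, degRank_table]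

/-- **`𝒢'_Π = 1`**: the witness is PRIMITIVE. [cite: GreenGriffithsKerr2012, (V.A.8) p. 157 and (V.A.4) p. 156] -/
theorem galoisStabilizer_eq_bot : Λ.galoisStabilizer (AlgHom.id ℚ L) ι = ⊥ := by
  rw [← rightStabilizer_galoisDeg, galoisDeg_eq_table_comp ι e Λ hΛ, Subgroup.eq_bot_iff_forall]
  intro u hu
  rw [mem_rightStabilizer_iff] at hu
  have h1 : e u ∈ rightStabilizer (fun x : Multiplicative (ZMod 6) =>
      if (Multiplicative.toAdd x).val ≤ 1 then (2 : ℤ)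
        else if (Multiplicative.toAdd x).val = 2 ∨ (Multiplicative.toAdd x).val = 5 then 1 else 0) := by
    rw [mem_rightStabilizer_iff]
    intro x
    have h2 := hu (e.symm x)
    simp only [Function.comp_apply, map_mul, MulEquiv.apply_symm_apply] at h2
    exact h2
  rw [rightStabilizer_table_eq_bot, Subgroup.mem_bot] at h1
  exact e.injective (by rw [h1, map_one])

/-- **`[F″:ℚ] = 6`** (`F″ = L`). [cite: GreenGriffithsKerr2012, (V.A.8) p. 157] -/
theorem finrank_doubleReflexField_eq_six : Module.finrank ℚ (Λ.doubleReflexField (AlgHom.id ℚ L) ι) = 6 := by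
  rw [← index_galoisStabilizer, galoisStabilizer_eq_bot ι e Λ hΛ, Subgroup.index_bot, IsGalois.card_aut_eq_finrank, finrank_eq_six e]

/-- **NOT strongly nondegenerate**: `𝓡(L,Π) = 3 ≠ 4 = ½[L:ℚ] + 1` (consistent with g29-#1: strong nondegeneracy forces `−id ∈ M_φ`, which fails here).
[cite: GreenGriffithsKerr2012, (V.A.7) p. 157] -/
theorem not_isStronglyNondegenerate : ¬Λ.IsStronglyNondegenerate (AlgHom.id ℚ L) ι := by
  rw [isStronglyNondegenerate_iff, kubotaRank_eq_three ι e Λ hΛ, finrank_eq_six e]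
  decide

/-- **DEGENERATE**: `𝓡(L,Π) = 3 ≠ 4 = ½[F″:ℚ] + 1` although `½[F″:ℚ] = 3 ≤ 3` — (V.A.9)(iii) fails in weight `2` for an honest SCMpHS (the tree's group-level
`degenerate_of_index_six`). [cite: GreenGriffithsKerr2012, (V.A.9) (iii) p. 157] -/
theorem not_isNondegenerate : ¬Λ.IsNondegenerate (AlgHom.id ℚ L) ι := by
  rw [isNondegenerate_iff, kubotaRank_eq_three ι e Λ hΛ, finrank_doubleReflexField_eq_six ι e Λ hΛ]
  decide

/-- **GGK's degenerate weight-`2` example has `−id ∉ M_φ`**: `𝓡(L,Π) = 3` and `−id ∉ M_φ(V²_{(L,Π)})(ℂ)` (g29-#3). [cite: GreenGriffithsKerr2012, (V.A.8) p. 157 and §V Warning p. 154]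
[cite: Deligne1982HodgeCycles, I Example 3.7 (d)] -/
theorem kubotaRank_eq_three_and_smulOfUnit_neg_one_not_mem [HodgeTensorFacts.{0, 0}] :
    Λ.kubotaRank (AlgHom.id ℚ L) ι = 3 ∧
      (LinearEquiv.smulOfUnit (-1 : ℂˣ) : (ℂ ⊗[ℚ] L) ≃ₗ[ℂ] (ℂ ⊗[ℚ] L)) ∉ (ofOrientation Λ).hodgeGroupBaseChange ℂ := by
  exact ⟨kubotaRank_eq_three ι e Λ hΛ, smulOfUnit_neg_one_not_mem_hodgeGroupBaseChange_complex ι e Λ hΛ⟩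

end CyclicSextic

/-! ### §3 Unconditionally on `ℚ(ζ₇)` -/

/-- `ℚ(ζ₇)` is the `7`-th cyclotomic extension of `ℚ` (named instance term). [folklore] -/
private theorem isCyclotomicExtension_cf7r : IsCyclotomicExtension {7} ℚ (CyclotomicField 7 ℚ) :=
  CyclotomicField.isCyclotomicExtension 7 ℚ

/-- `ℚ(ζ₇)/ℚ` is Galois. [folklore] -/
private theorem isGalois_cf7r : IsGalois ℚ (CyclotomicField 7 ℚ) :=
  haveI := isCyclotomicExtension_cf7r
  IsCyclotomicExtension.isGalois {7} ℚ (CyclotomicField 7 ℚ)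

/-- `ℚ(ζ₇)` is a CM field. [folklore] -/
private theorem isCMField_cf7r : IsCMField (CyclotomicField 7 ℚ) :=
  @IsCyclotomicExtension.Rat.isCMField (CyclotomicField 7 ℚ) _ _ {7} ⟨7, Set.mem_singleton 7, by norm_num⟩ isCyclotomicExtension_cf7r

/-- **GGK's (V.A.8) example as an honest SCMpHS on `ℚ(ζ₇)`**: for every `ι : ℚ(ζ₇) → ℂ` there is a `2`-orientation `Π` of `ℚ(ζ₇)` with `𝓡(ℚ(ζ₇),Π) = 3`,
`[F″:ℚ] = 6` (primitive), NOT nondegenerate ((V.A.9)(iii) fails in weight `2`), NOT strongly nondegenerate, and `−id ∉ M_φ(V²_{(ℚ(ζ₇),Π)})(ℂ)`.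
[cite: GreenGriffithsKerr2012, (V.A.8)–(V.A.9) p. 157] [cite: Deligne1982HodgeCycles, I Example 3.7 (d)] -/
theorem exists_orientation_cyclotomicField_seven_kubotaRank [HodgeTensorFacts.{0, 0}] (ι : CyclotomicField 7 ℚ →+* ℂ) :
    ∃ Λ : Orientation (CyclotomicField 7 ℚ) 2,
      Λ.kubotaRank (AlgHom.id ℚ (CyclotomicField 7 ℚ)) ι = 3 ∧
      Module.finrank ℚ (Λ.doubleReflexField (AlgHom.id ℚ (CyclotomicField 7 ℚ)) ι) = 6 ∧
      ¬Λ.IsNondegenerate (AlgHom.id ℚ (CyclotomicField 7 ℚ)) ι ∧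
      ¬Λ.IsStronglyNondegenerate (AlgHom.id ℚ (CyclotomicField 7 ℚ)) ι ∧
      (LinearEquiv.smulOfUnit (-1 : ℂˣ) : (ℂ ⊗[ℚ] CyclotomicField 7 ℚ) ≃ₗ[ℂ] (ℂ ⊗[ℚ] CyclotomicField 7 ℚ)) ∉
          (ofOrientation Λ).hodgeGroupBaseChange ℂ := by
  obtain ⟨e⟩ := nonempty_mulEquiv_gal_cyclotomicField_seven
  haveI := isGalois_cf7r
  haveI := isCMField_cf7r
  obtain ⟨Λ, hΛ⟩ := exists_orientation_deg_comp_eq ι e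
  exact ⟨Λ, kubotaRank_eq_three ι e Λ hΛ, finrank_doubleReflexField_eq_six ι e Λ hΛ, not_isNondegenerate ι e Λ hΛ,
    not_isStronglyNondegenerate ι e Λ hΛ, smulOfUnit_neg_one_not_mem_hodgeGroupBaseChange_complex ι e Λ hΛ⟩

end HodgeStructure

end Literature.AlgebraicGeometry.Motives

end
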